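import Summits.QuantumFields.YangMills.Theorems.ColdStartUniversalityLatticeLangevinGaugeCovariance
import Summits.QuantumFields.YangMills.Theorems.ColdStartUniversalityLatticeLangevinLawUniqueStart
import HarnessLib

/-!
# Route `ColdStartUniversality` (brick «G4(v)» — GAUGE COVARIANCE IN LAW of the SU(2) lattice Langevin dynamics):
# `law(h·u ⇝ t) = (h·)_* law(u ⇝ t)`, covariance of the transition kernels and of the Markov semigroup

Helper file (seat `ym-line-csu-p1`, g11; `--supports stmt-QuantumFields-24810`).  Packaging of the pathwise transfer
`GaugeCovariance.isSolution_gaugeTransform` (file `…GaugeCovariance`) with uniqueness in law from every start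
(`lawUnique_of_start`) and the regular flow (`exists_regularFlow`):

* `exists_gaugeTransformed_solution` — on every probability space (in `Type`) with a flat driver and for every start `u`
  and gauge transformation `h` there are a solution `V` from `u` and, on the SAME space, a flat driver `W'` with a
  solution `V'` from `h·u` such that `V'_t = h·V_t` surely;
* ★ `map_gaugeTransform_eq` — for ANY solution `V` from `u` and ANY solution `V'` from `h·u` (each on its own
  probability space, own flat driver): `law(V'_t) = (h·)_* law(V_t)` for all `t`;
* `transitionKernel_gaugeTransform` — for any family of kernels `κ_t` realising the transition laws (the conclusion of
  `exists_transitionKernel`): `κ_t (h·x) = (κ_t x).map (h·)`;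
* `markovTransition_gaugeTransform`, `isGaugeInvariant_markovTransition` — `P_t f (h·x) = P_t (f ∘ h·) x` for every
  solution family and every measurable `f`; `P_t` preserves gauge-invariant measurable observables.

This is what the K_A2 / TransportPerturbation currencies modulo gauge (`discG`, `wdisc`, `wd_K`) need from the dynamics
(CSU lead memo g10 §3(c)).  THEOREMS ONLY, [folklore]; RECORD-rung R3 plumbing; no crux or summit is proved; the
Yang–Mills mass gap is NOT proved.
-/

set_option autoImplicit false

noncomputable section

namespace Summit.QuantumFields.YangMills.Theorems.ColdStartUniversality.GaugeCovariance

open MeasureTheory ProbabilityTheory Filter Matrix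
open scoped NNReal ENNReal BigOperators
open Literature.Probability.Process Literature.MathematicalPhysics.QuantumFieldTheory
open Literature.MathematicalPhysics.QuantumLattice (fundamentalRep fundamentalLatticeRep)

variable {L : ℕ} [NeZero L]

/-- `gaugeTransform h` is a measurable self-map of the `SU(2)` configuration space. [folklore] -/
theorem measurable_gaugeTransform
    (h : Literature.MathematicalPhysics.QuantumFieldTheory.Site 3 L → Matrix.specialUnitaryGroup (Fin 2) ℂ) :
    Measurable (gaugeTransform h : GaugeConfig 3 L (Matrix.specialUnitaryGroup (Fin 2) ℂ) →
      GaugeConfig 3 L (Matrix.specialUnitaryGroup (Fin 2) ℂ)) :=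
  measurable_gaugeTransform_comp h measurable_id

/-- ★ **A solution from `u` and a solution from `h·u` on the same space, the second the gauge transform of the first.**
On every probability space with a flat driver `W` and for every start `u` there are a solution `V` of the SU(2)
lattice Langevin dynamics from `u` driven by `W`, a flat driver `W'` on the same space (the `Ad_h`-rotated noise) and a
solution `V'` from `h·u` driven by `W'`, with `V'_t(ω) = h·V_t(ω)` for all `t, ω`. [folklore] -/
theorem exists_gaugeTransformed_solution (β' : ℝ)
    (h : Literature.MathematicalPhysics.QuantumFieldTheory.Site 3 L → Matrix.specialUnitaryGroup (Fin 2) ℂ)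
    {Ω : Type} [MeasurableSpace Ω] {P : Measure Ω} [IsProbabilityMeasure P]
    {W : ℝ≥0 → Ω → (Edge 3 L × NoiseIdx 2 → ℝ)} (hW : IsFlatBrownian W P)
    (u : GaugeConfig 3 L (Matrix.specialUnitaryGroup (Fin 2) ℂ)) :
    ∃ (V : ℝ≥0 → Ω → GaugeConfig 3 L (Matrix.specialUnitaryGroup (Fin 2) ℂ))
      (W' : ℝ≥0 → Ω → (Edge 3 L × NoiseIdx 2 → ℝ)) (hW' : IsFlatBrownian W' P)
      (V' : ℝ≥0 → Ω → GaugeConfig 3 L (Matrix.specialUnitaryGroup (Fin 2) ℂ)),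
      (∀ ω, V 0 ω = u) ∧
      (latticeLangevinDynamics (fundamentalLatticeRep 2) β').IsSolution (fundamentalRep (Fin 2))
        hW.natFiltration P W V ∧
      (∀ ω, V' 0 ω = gaugeTransform h u) ∧
      (latticeLangevinDynamics (fundamentalLatticeRep 2) β').IsSolution (fundamentalRep (Fin 2))
        hW'.natFiltration P W' V' ∧
      ∀ t ω, V' t ω = gaugeTransform h (V t ω) := by
  classical
  obtain ⟨U, G, hUsol, hUmeas, -, -, -⟩ := exists_regularFlow L β' hW
  -- the `Ad` matrices of `h`
  set R : Edge 3 L → Matrix (NoiseIdx 2) (NoiseIdx 2) ℝ := fun e => Matrix.of fun m n : NoiseIdx (fundamentalLatticeRep 2).N =>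
    hsForm (fundamentalLatticeRep 2).N ((fundamentalLatticeRep 2).ρ (h e.1) * noiseDir n *
      ((fundamentalLatticeRep 2).ρ (h e.1))ᴴ) (noiseDir m) with hRdef
  have hR : ∀ (e : Edge 3 L) (m n : NoiseIdx (fundamentalLatticeRep 2).N), R e m n =
      hsForm (fundamentalLatticeRep 2).N ((fundamentalLatticeRep 2).ρ (h e.1) * noiseDir n *
        ((fundamentalLatticeRep 2).ρ (h e.1))ᴴ) (noiseDir m) := fun e m n => rfl
  have hflow := isSolution_gaugeTransform_flow β' hW h R hR hUsol hUmeas u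
  have hRo := adMatrix_gauge_orthogonal h R hR
  have hWR := isFlatBrownian_gaugeRotation hW R hRo
  have hF := natFiltration_gaugeRotation_eq hW R hRo hWR
  refine ⟨U u, _, hWR, fun t ω => gaugeTransform h (U u t ω), (hUsol u).1, (hUsol u).2, hflow.1, ?_, fun _ _ => rfl⟩
  rw [hF]
  exact hflow.2

/-- ★★ **Gauge covariance in law of the SZZ dynamics.**  For every start `u`, every gauge transformation `h`, every
solution `V` from `u` and every solution `V'` from `h·u` (each on its own probability space in `Type` with its own flat
driver, raw natural filtrations): `law(V'_t) = (h·)_* law(V_t)` for all `t`. [folklore] -/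
theorem map_gaugeTransform_eq (β' : ℝ)
    (h : Literature.MathematicalPhysics.QuantumFieldTheory.Site 3 L → Matrix.specialUnitaryGroup (Fin 2) ℂ)
    (u : GaugeConfig 3 L (Matrix.specialUnitaryGroup (Fin 2) ℂ))
    {Ω : Type} {mΩ : MeasurableSpace Ω} {P : Measure Ω} [IsProbabilityMeasure P]
    {W : ℝ≥0 → Ω → (Edge 3 L × NoiseIdx 2 → ℝ)} (hW : IsFlatBrownian W P)
    {V : ℝ≥0 → Ω → GaugeConfig 3 L (Matrix.specialUnitaryGroup (Fin 2) ℂ)}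
    (hV0 : ∀ ω, V 0 ω = u)
    (hV : (latticeLangevinDynamics (fundamentalLatticeRep 2) β').IsSolution (fundamentalRep (Fin 2))
      hW.natFiltration P W V)
    {Ω' : Type} {mΩ' : MeasurableSpace Ω'} {P' : Measure Ω'} [IsProbabilityMeasure P']
    {W' : ℝ≥0 → Ω' → (Edge 3 L × NoiseIdx 2 → ℝ)} (hW' : IsFlatBrownian W' P')
    {V' : ℝ≥0 → Ω' → GaugeConfig 3 L (Matrix.specialUnitaryGroup (Fin 2) ℂ)}
    (hV'0 : ∀ ω, V' 0 ω = gaugeTransform h u)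
    (hV' : (latticeLangevinDynamics (fundamentalLatticeRep 2) β').IsSolution (fundamentalRep (Fin 2))
      hW'.natFiltration P' W' V') (t : ℝ≥0) :
    Measure.map (V' t) P' = (Measure.map (V t) P).map (gaugeTransform h) := by
  obtain ⟨V₀, W₀, hW₀, V₀', hV₀0, hV₀, hV₀'0, hV₀', hVV⟩ := exists_gaugeTransformed_solution β' h hW u
  have h1 : Measure.map (V t) P = Measure.map (V₀ t) P := lawUnique_of_start β' u hW hW hV0 hV hV₀0 hV₀ t
  have h2 : Measure.map (V' t) P' = Measure.map (V₀' t) P :=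
    lawUnique_of_start β' (gaugeTransform h u) hW' hW₀ hV'0 hV' hV₀'0 hV₀' t
  have hmV₀ : Measurable (V₀ t) := (hV₀.adapted t).mono (hW.natFiltration.le t) le_rfl
  have h3 : (fun ω => V₀' t ω) = gaugeTransform h ∘ V₀ t := funext fun ω => hVV t ω
  rw [h2, h1, Measure.map_map (measurable_gaugeTransform h) hmV₀, ← h3]

/-- ★ **The transition kernels are gauge covariant**: for any family of kernels `κ_t` realising the transition laws of
the SZZ dynamics (the conclusion of `exists_transitionKernel`), `κ_t (h·x) = (κ_t x).map (h·)`. [folklore] -/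
theorem transitionKernel_gaugeTransform (β' : ℝ)
    (κ : ℝ≥0 → Kernel (GaugeConfig 3 L (Matrix.specialUnitaryGroup (Fin 2) ℂ))
      (GaugeConfig 3 L (Matrix.specialUnitaryGroup (Fin 2) ℂ)))
    (hκ : ∀ (t : ℝ≥0) (x : GaugeConfig 3 L (Matrix.specialUnitaryGroup (Fin 2) ℂ))
        (Ω : Type) [MeasurableSpace Ω] (P : Measure Ω) [IsProbabilityMeasure P]
        (W : ℝ≥0 → Ω → (Edge 3 L × NoiseIdx 2 → ℝ)) (hW : IsFlatBrownian W P)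
        (U : ℝ≥0 → Ω → GaugeConfig 3 L (Matrix.specialUnitaryGroup (Fin 2) ℂ)),
        (∀ ω, U 0 ω = x) →
        (latticeLangevinDynamics (fundamentalLatticeRep 2) β').IsSolution (fundamentalRep (Fin 2))
          hW.natFiltration P W U →
        κ t x = P.map (U t))
    (h : Literature.MathematicalPhysics.QuantumFieldTheory.Site 3 L → Matrix.specialUnitaryGroup (Fin 2) ℂ)
    (t : ℝ≥0) (x : GaugeConfig 3 L (Matrix.specialUnitaryGroup (Fin 2) ℂ)) :
    κ t (gaugeTransform h x) = (κ t x).map (gaugeTransform h) := by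
  haveI := isProbabilityMeasure_piWiener (Edge 3 L × NoiseIdx 2)
  have hWc := isFlatBrownian_piWiener 3 L (NoiseIdx 2)
  obtain ⟨V₀, W₀, hW₀, V₀', hV₀0, hV₀, hV₀'0, hV₀', hVV⟩ := exists_gaugeTransformed_solution β' h hWc x
  rw [hκ t x _ _ _ hWc V₀ hV₀0 hV₀, hκ t (gaugeTransform h x) _ _ _ hW₀ V₀' hV₀'0 hV₀']
  exact map_gaugeTransform_eq β' h x hWc hV₀0 hV₀ hW₀ hV₀'0 hV₀' t

/-- ★ **The Markov semigroup is gauge covariant**: for every solution family `(U^x)_x` of the SZZ dynamics on one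
probability space (started at every `x`, one flat driver), every measurable `f` and every `t`,
`P_t f (h·x) = P_t (f ∘ h·) x`, i.e. `E f(U^{h·x}_t) = E f(h·U^x_t)`. [folklore] -/
theorem markovTransition_gaugeTransform (β' : ℝ)
    {Ω : Type} {mΩ : MeasurableSpace Ω} {P : Measure Ω} [IsProbabilityMeasure P]
    {W : ℝ≥0 → Ω → (Edge 3 L × NoiseIdx 2 → ℝ)} (hW : IsFlatBrownian W P)
    {U : GaugeConfig 3 L (Matrix.specialUnitaryGroup (Fin 2) ℂ) → ℝ≥0 → Ω →
      GaugeConfig 3 L (Matrix.specialUnitaryGroup (Fin 2) ℂ)}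
    (hU : ∀ x, (∀ ω, U x 0 ω = x) ∧
      (latticeLangevinDynamics (fundamentalLatticeRep 2) β').IsSolution (fundamentalRep (Fin 2))
        hW.natFiltration P W (U x))
    (h : Literature.MathematicalPhysics.QuantumFieldTheory.Site 3 L → Matrix.specialUnitaryGroup (Fin 2) ℂ)
    {f : GaugeConfig 3 L (Matrix.specialUnitaryGroup (Fin 2) ℂ) → ℝ} (hf : Measurable f) (t : ℝ≥0)
    (x : GaugeConfig 3 L (Matrix.specialUnitaryGroup (Fin 2) ℂ)) :
    markovTransition U P t f (gaugeTransform h x) = markovTransition U P t (f ∘ gaugeTransform h) x := by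
  have hlaw := map_gaugeTransform_eq β' h x hW (hU x).1 (hU x).2 hW (hU (gaugeTransform h x)).1
    (hU (gaugeTransform h x)).2 t
  have hm : ∀ y, Measurable (U y t) := fun y => ((hU y).2.adapted t).mono (hW.natFiltration.le t) le_rfl
  unfold markovTransition
  calc ∫ ω, f (U (gaugeTransform h x) t ω) ∂P
      = ∫ v, f v ∂(Measure.map (U (gaugeTransform h x) t) P) :=
        (integral_map (hm _).aemeasurable hf.aestronglyMeasurable).symm
    _ = ∫ v, f v ∂((Measure.map (U x t) P).map (gaugeTransform h)) := by rw [hlaw]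
    _ = ∫ v, (f ∘ gaugeTransform h) v ∂(Measure.map (U x t) P) :=
        integral_map (measurable_gaugeTransform h).aemeasurable hf.aestronglyMeasurable
    _ = ∫ ω, (f ∘ gaugeTransform h) (U x t ω) ∂P :=
        integral_map (hm _).aemeasurable (hf.comp (measurable_gaugeTransform h)).aestronglyMeasurable

/-- **`P_t` preserves gauge-invariant measurable observables**: if `f` is gauge invariant then so is
`P_t f = x ↦ E f(U^x_t)`, for every solution family. [folklore] -/
theorem isGaugeInvariant_markovTransition (β' : ℝ)
    {Ω : Type} {mΩ : MeasurableSpace Ω} {P : Measure Ω} [IsProbabilityMeasure P]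
    {W : ℝ≥0 → Ω → (Edge 3 L × NoiseIdx 2 → ℝ)} (hW : IsFlatBrownian W P)
    {U : GaugeConfig 3 L (Matrix.specialUnitaryGroup (Fin 2) ℂ) → ℝ≥0 → Ω →
      GaugeConfig 3 L (Matrix.specialUnitaryGroup (Fin 2) ℂ)}
    (hU : ∀ x, (∀ ω, U x 0 ω = x) ∧
      (latticeLangevinDynamics (fundamentalLatticeRep 2) β').IsSolution (fundamentalRep (Fin 2))
        hW.natFiltration P W (U x))
    {f : GaugeConfig 3 L (Matrix.specialUnitaryGroup (Fin 2) ℂ) → ℝ} (hf : Measurable f)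
    (hinv : IsGaugeInvariant f) (t : ℝ≥0) :
    IsGaugeInvariant (markovTransition U P t f) := by
  intro h x
  rw [markovTransition_gaugeTransform β' hW hU h hf t x]
  have hfh : f ∘ gaugeTransform h = f := funext fun v => hinv h v
  rw [hfh]

end Summit.QuantumFields.YangMills.Theorems.ColdStartUniversality.GaugeCovariance

end
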